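import Literature.NumberTheory.NumberFields.DyadicResidue
import HarnessLib

/-!
# Rank mod `3` barrier: the local image at a split dyadic prime — finite checks

Towards the named fact
`Literature.Barriers.BirchSwinnertonDyer.DokchitserDokchitser2011_descent_480a1_F3_cubic`
(`rk E(K_σ) ≤ 1` for `E = 480a1 : y² = x(x+2)(x-3)` over the four cubic subfields of
`F₃ ⊂ ℚ(ζ₁₃, ζ₁₀₃)`, T. Dokchitser–V. Dokchitser, proof of Thm. 2): the `2`-adic local analysis at
a dyadic prime of DEGREE ONE (`K_𝔭 = ℚ₂`, needed for the cubic subfield in which `2` splits, where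
moreover the primes above `2` are not principal), phrased with the residue relation `HasRes` of
`Literature/NumberTheory/NumberFields/DyadicResidue.lean`.

This file: the finite arithmetic modulo `128` (`cast8`, `oddPart`, solving `2^d t = w`), the
encoded local image `Hlist` of `E(ℚ₂)/2E(ℚ₂)` for `E : y² = x(x+2)(x-3)`
(`{(1,1), (-6,2), (-2,10), (3,5), (-1,1), (6,2), (2,10), (-3,5)}` as (parity of `ord`, unit part
modulo `8`) pairs), and the four kernel-checked finite statements (`checkA` for `ord x ≤ -1`,
`checkC` generic, `checkC2`, `checkC3` deep at the `2`-torsion points `(-2,0)`, `(3,0)`) to which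
the case analysis of `…SplitDyadic.lean` reduces.
[cite: SilvermanAEC2009, Prop. X.1.4]

## References

* J. H. Silverman, *The Arithmetic of Elliptic Curves*, 2nd ed., GTM 106 (2009): §X.1, Prop. X.1.4
  (local computations of the complete `2`-descent). [SilvermanAEC2009]
* T. Dokchitser, V. Dokchitser, *A note on the Mordell–Weil rank modulo `n`*, J. Number Theory 131
  (2011) 1833–1839, arXiv:0910.4588: proof of Thm. 2. [DokchitserDokchitser2011RankModN]
-/

noncomputable section

open Polynomial Module NumberField Ideal
open scoped NumberField

namespace Literature.Barriers.BirchSwinnertonDyer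

namespace DokchitserDokchitser2011

open Literature.NumberTheory.NumberFields Literature.NumberTheory.NumberFields.DyadicPlace
open IsDedekindDomain IsDedekindDomain.HeightOneSpectrum

variable {K : Type*} [Field K] [NumberField K]

/-! ### Finite arithmetic modulo `128` -/

/-- Reduction `ℤ/128 → ℤ/8`. [folklore] -/
def cast8 : ZMod 128 →+* ZMod 8 := ZMod.castHom (by norm_num) (ZMod 8)

/-- The odd part of a residue modulo `128` (`1` for `0`). [folklore] -/
def oddPart (x : ZMod 128) : ZMod 128 := if x = 0 then 1 else (x.val / 2 ^ val2 x : ℕ)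

/-- `w = 2^(val2 w) · oddPart w` for `w ≠ 0`, with `oddPart w` odd and `val2 w ≤ 6`. [folklore] -/
theorem val2_spec : ∀ w : ZMod 128, w ≠ 0 →
    w = 2 ^ val2 w * oddPart w ∧ ¬ 2 ∣ (oddPart w).val ∧ val2 w ≤ 6 := by decide +kernel

/-- `2^d t = 2^d o` with `d ≤ 4` gives `t ≡ o (mod 8)`. [folklore] -/
theorem cast8_eq_of_pow_mul_eq : ∀ d : Fin 5, ∀ t o : ZMod 128,
    (2 : ZMod 128) ^ (d : ℕ) * t = 2 ^ (d : ℕ) * o → cast8 t = cast8 o := by decide +kernel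

/-- `2^d t = 0` with `t` odd forces `d ≥ 7`. [folklore] -/
theorem seven_le_of_pow_mul_eq_zero {d : ℕ} {t : ZMod 128} (ht : ¬ 2 ∣ t.val)
    (h : (2 : ZMod 128) ^ d * t = 0) : 7 ≤ d := by
  by_contra hlt
  push Not at hlt
  have key : ∀ d : Fin 7, ∀ t : ZMod 128, ¬ 2 ∣ t.val → (2 : ZMod 128) ^ (d : ℕ) * t ≠ 0 := by
    decide +kernel
  exact key ⟨d, hlt⟩ t ht h

/-- `2^m = 2^(min m 7)` in `ℤ/128`. [folklore] -/
theorem two_pow_eq_min (m : ℕ) : (2 : ZMod 128) ^ m = 2 ^ min m 7 := by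
  rcases le_or_gt m 7 with h | h
  · rw [min_eq_left h]
  · rw [min_eq_right h.le]
    obtain ⟨d, rfl⟩ := Nat.exists_eq_add_of_lt h
    rw [show 7 + d + 1 = 7 + (d + 1) by ring, pow_add, show (2 : ZMod 128) ^ 7 = 0 by decide,
      zero_mul]

/-- **Solving `2^d t = w`** (`t` odd, `w ≠ 0`): `d = val2 w`, and `t ≡ oddPart w (mod 8)` if
`val2 w ≤ 4`. [folklore] -/
theorem eq_val2_of_pow_mul_eq {d : ℕ} {t w : ZMod 128} (ht : ¬ 2 ∣ t.val) (hw : w ≠ 0)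
    (h : (2 : ZMod 128) ^ d * t = w) :
    d = val2 w ∧ (val2 w ≤ 4 → cast8 t = cast8 (oddPart w)) := by
  obtain ⟨hdec, hodd, hle⟩ := val2_spec w hw
  have hd7 : d < 7 := by
    by_contra hge
    push Not at hge
    obtain ⟨e, rfl⟩ := Nat.exists_eq_add_of_le hge
    rw [pow_add, show (2 : ZMod 128) ^ 7 = 0 by decide, zero_mul, zero_mul] at h
    exact hw h.symm
  have hdv : d = val2 w := by
    have := pow_two_mul_odd_inj (m := d) (n := val2 w) ht hodd (by omega) (by rw [h, ← hdec])
    exact this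
  refine ⟨hdv, fun h4 => ?_⟩
  subst hdv
  exact cast8_eq_of_pow_mul_eq ⟨val2 w, by omega⟩ t (oddPart w) (by rw [h, ← hdec])

/-! ### The local image `H` of `E(ℚ₂)/2E(ℚ₂)` for `E : y² = x(x+2)(x-3)` -/

/-- The image of `E(ℚ₂)/2E(ℚ₂)` in `(ℚ₂ˣ/ℚ₂ˣ²)²` under `(x, x + 2)`, `E : y² = x(x+2)(x-3)`:
`{(1,1), (-6,2), (-2,10), (3,5), (-1,1), (6,2), (2,10), (-3,5)}` encoded as
`(ord mod 2, unit part mod 8)` pairs. [cite: SilvermanAEC2009, Prop. X.1.4] -/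
def Hlist : List (Fin 2 × ZMod 8 × Fin 2 × ZMod 8) :=
  [(0, 1, 0, 1), (1, 5, 1, 1), (1, 7, 1, 5), (0, 3, 0, 5), (0, 7, 0, 1), (1, 3, 1, 1), (1, 1, 1, 5),
    (0, 5, 0, 5)]

/-- The parity of an integer as an element of `Fin 2`. [folklore] -/
def par (n : ℤ) : Fin 2 := if 2 ∣ n then 0 else 1

set_option synthInstance.maxSize 16384 in
set_option synthInstance.maxHeartbeats 800000 in
/-- **Finite check, `ord x ≤ -1`** (`n = ord(x)⁻¹… `): with `k = min n 7 ≥ 1`, `p = n mod 2`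
(`3n` even), and `x ≡ r`, `x + 2 ≡ r + 2^(n+1)`, `x - 3 ≡ r - 3·2^n` with product a square
`≡ 1 (mod 8)`, the pair is in `H`. [folklore] -/
theorem checkA : ∀ k : Fin 8, ∀ p : Fin 2, ∀ r : ZMod 128, 1 ≤ (k : ℕ) →
    ((k : ℕ) < 7 → (p : ℕ) = (k : ℕ) % 2) →
    (p : ℕ) = 0 → ¬ 2 ∣ r.val →
    cast8 (r * (r + 2 ^ ((k : ℕ) + 1)) * (r - 3 * 2 ^ (k : ℕ))) = 1 →
    (p, cast8 r, p, cast8 (r + 2 ^ ((k : ℕ) + 1))) ∈ Hlist := by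
  decide +kernel

set_option synthInstance.maxSize 16384 in
set_option synthInstance.maxHeartbeats 800000 in
/-- **Finite check, `ord x = m ≥ 0`, generic depth**: `w₂ = 2^m r + 2`, `w₃ = 2^m r - 3` of `2`-adic
valuation `≤ 4`. [folklore] -/
theorem checkC : ∀ k : Fin 8, ∀ p : Fin 2, ∀ r : ZMod 128, ((k : ℕ) < 7 → (p : ℕ) = (k : ℕ) % 2) →
    ¬ 2 ∣ r.val →
    (2 : ZMod 128) ^ (k : ℕ) * r + 2 ≠ 0 → val2 (2 ^ (k : ℕ) * r + 2) ≤ 4 →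
    (2 : ZMod 128) ^ (k : ℕ) * r - 3 ≠ 0 → val2 (2 ^ (k : ℕ) * r - 3) ≤ 4 →
    2 ∣ (p : ℕ) + val2 (2 ^ (k : ℕ) * r + 2) + val2 (2 ^ (k : ℕ) * r - 3) →
    cast8 r * cast8 (oddPart (2 ^ (k : ℕ) * r + 2)) * cast8 (oddPart (2 ^ (k : ℕ) * r - 3)) = 1 →
    (p, cast8 r, par (val2 (2 ^ (k : ℕ) * r + 2)),
      cast8 (oddPart (2 ^ (k : ℕ) * r + 2))) ∈ Hlist := by
  decide +kernel

set_option synthInstance.maxSize 16384 in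
set_option synthInstance.maxHeartbeats 800000 in
/-- **Finite check, deep at `T₂ = (-2, 0)`** (`val2 (2^m r + 2) ≥ 5`: then `x - 3` is a unit and the
residue `t` of `x + 2` is constrained only by the square condition). [folklore] -/
theorem checkC2 : ∀ k : Fin 8, ∀ p : Fin 2, ∀ r : ZMod 128, ((k : ℕ) < 7 → (p : ℕ) = (k : ℕ) % 2) →
    ¬ 2 ∣ r.val → ¬ ((2 : ZMod 128) ^ (k : ℕ) * r + 2 ≠ 0 ∧ val2 (2 ^ (k : ℕ) * r + 2) ≤ 4) →
    ∀ kd : Fin 8, ∀ pd : Fin 2, ∀ t : ZMod 128, ((kd : ℕ) < 7 → (pd : ℕ) = (kd : ℕ) % 2) →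
    ¬ 2 ∣ t.val → (2 : ZMod 128) ^ (kd : ℕ) * t = 2 ^ (k : ℕ) * r + 2 →
    (2 : ZMod 128) ^ (k : ℕ) * r - 3 ≠ 0 → val2 (2 ^ (k : ℕ) * r - 3) ≤ 4 →
    2 ∣ (p : ℕ) + pd + val2 (2 ^ (k : ℕ) * r - 3) →
    cast8 r * cast8 t * cast8 (oddPart (2 ^ (k : ℕ) * r - 3)) = 1 →
    (p, cast8 r, pd, cast8 t) ∈ Hlist := by
  decide +kernel

set_option synthInstance.maxSize 16384 in
set_option synthInstance.maxHeartbeats 800000 in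
/-- **Finite check, deep at `T₃ = (3, 0)`** (`val2 (2^m r - 3) ≥ 5`). [folklore] -/
theorem checkC3 : ∀ k : Fin 8, ∀ p : Fin 2, ∀ r : ZMod 128, ((k : ℕ) < 7 → (p : ℕ) = (k : ℕ) % 2) →
    ¬ 2 ∣ r.val → ¬ ((2 : ZMod 128) ^ (k : ℕ) * r - 3 ≠ 0 ∧ val2 (2 ^ (k : ℕ) * r - 3) ≤ 4) →
    ∀ kd : Fin 8, ∀ pd : Fin 2, ∀ u : ZMod 128, ((kd : ℕ) < 7 → (pd : ℕ) = (kd : ℕ) % 2) →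
    ¬ 2 ∣ u.val → (2 : ZMod 128) ^ (kd : ℕ) * u = 2 ^ (k : ℕ) * r - 3 →
    (2 : ZMod 128) ^ (k : ℕ) * r + 2 ≠ 0 → val2 (2 ^ (k : ℕ) * r + 2) ≤ 4 →
    2 ∣ (p : ℕ) + val2 (2 ^ (k : ℕ) * r + 2) + pd →
    cast8 r * cast8 (oddPart (2 ^ (k : ℕ) * r + 2)) * cast8 u = 1 →
    (p, cast8 r, par (val2 (2 ^ (k : ℕ) * r + 2)),
      cast8 (oddPart (2 ^ (k : ℕ) * r + 2))) ∈ Hlist := by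
  decide +kernel


/-! ### Small helpers -/

/-- `par n` as a natural number is `n mod 2`. [folklore] -/
theorem par_natCast_val (n : ℕ) : ((par n : Fin 2) : ℕ) = n % 2 := by
  unfold par
  split_ifs with h
  · simp only [Fin.val_zero]; omega
  · simp only [Fin.val_one]; omega

/-- `par (-n) = par n`. [folklore] -/
theorem par_neg (n : ℤ) : par (-n) = par n := by
  unfold par; simp only [dvd_neg]

/-- `par` of an even integer is `0`. [folklore] -/
theorem par_eq_zero {n : ℤ} (h : 2 ∣ n) : par n = 0 := by
  unfold par; rw [if_pos h]

/-- `par d` from `min d 7`: if `min d 7 < 7` then `par d = (min d 7) % 2`. [folklore] -/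
theorem par_min (d : ℕ) : min d 7 < 7 → ((par d : Fin 2) : ℕ) = min d 7 % 2 := fun h => by
  rw [par_natCast_val, min_eq_left (by omega : d ≤ 7)]

/-- Odd squares are `1` modulo `8`. [folklore] -/
theorem cast8_sq_odd : ∀ s : ZMod 128, ¬ 2 ∣ s.val → cast8 (s ^ 2) = 1 := by decide +kernel

/-- `2^(n+1) = 2^(min n 7 + 1)` in `ℤ/128`. [folklore] -/
theorem two_pow_succ_eq_min (n : ℕ) : (2 : ZMod 128) ^ (n + 1) = 2 ^ (min n 7 + 1) := by
  rcases le_or_gt n 7 with h | h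
  · rw [min_eq_left h]
  · rw [min_eq_right h.le]
    obtain ⟨d, rfl⟩ := Nat.exists_eq_add_of_lt h
    rw [show 7 + d + 1 + 1 = 8 + (d + 1) by ring, pow_add, show (2 : ZMod 128) ^ 8 = 0 by decide,
      zero_mul]

/-- Cancelling an odd residue. [folklore] -/
theorem odd_mul_cancel {w A B : ZMod 128} (hw : ¬ 2 ∣ w.val) (h : w * A = w * B) : A = B := by
  have h32 := pow_32_eq_one w hw
  calc A = w ^ 31 * (w * A) := by rw [← mul_assoc, ← pow_succ, h32, one_mul]
    _ = w ^ 31 * (w * B) := by rw [h]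
    _ = B := by rw [← mul_assoc, ← pow_succ, h32, one_mul]

/-- Not both `x + 2` and `x - 3` can be deep. [folklore] -/
theorem gen_or : ∀ k : Fin 8, ∀ r : ZMod 128, ¬ 2 ∣ r.val →
    ((2 : ZMod 128) ^ (k : ℕ) * r + 2 ≠ 0 ∧ val2 (2 ^ (k : ℕ) * r + 2) ≤ 4) ∨
    ((2 : ZMod 128) ^ (k : ℕ) * r - 3 ≠ 0 ∧ val2 (2 ^ (k : ℕ) * r - 3) ≤ 4) := by decide +kernel

end DokchitserDokchitser2011

end Literature.Barriers.BirchSwinnertonDyer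

end
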